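import Summits.ResolutionOfSingularities.ResolutionOfSingularities.Theorems.FrobeniusClosingSteerConeBinary
import HarnessLib

/-!
# Cone file 5 (W4.1, idea-3 TV4 «welcome» 12:05:30Z; hNT4 support): MULTIPLICITY `d` AT A RATIONAL POINT ⇒ CONE OVER IT,
# for a general index type and any characteristic

W4.1, crux `Steer` (stmt-ResolutionOfSingularities-16345). `Cone.binary_of_mult_eq_deg` (p529177) is the instance `σ = Fin 3`; res-type-096's
`BinaryResidue.cone_fourVar_of_mult_eq_deg` (p531760) the instance `σ = Fin 4`, chart `X 1`. Here, once and for all σ and every chart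
`X_j ≠ 0` (seat res-D-pv-007 AS res-L0-w41-stub-5; no definitions — the re-homogenising substitution `η⁻_c : X_i ↦ X_i − c_i X_j` is an
explicit `aeval`):

* `dehomTransl_neg_dehomTransl` (`dehomTransl_j^{−c} ∘ dehomTransl_j^{c} = (X_j ↦ 1)`), `aeval_dehom_etaSub` (`(X_j ↦ 1) ∘ η⁻_c =
  dehomTransl_j^{−c}`), `isLineInvariant_aeval_etaSub` (`η⁻_c R` is invariant along `c` for `X_j`-free `R`, `c_j = 1`) — any characteristic;
* **`eq_aeval_etaSub_dehomTransl_of_order_ge`**: `Φ` a `d`-form whose dehomogenised translate `Ψ := dehomTransl_j^c Φ = Φ(X_j := 1,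
  X_i := X_i + c_i)` has all monomials of degree `≥ d` ⇒ `Ψ` is a `d`-form free of `X_j` and `Φ = Ψ(X_i − c_i X_j : i ≠ j)`;
* **`isLineInvariant_of_dehomTransl_order_ge`** (TV4 plain): … ⇒ `Φ` is invariant along `c` (`c_j = 1`): «multiplicity `d` at the rational
  point `c` of the chart ⇒ cone with vertex `c`». (The MOD-SQUARES version in characteristic `2` is `DescentSpace.mem_descentSpace_of_even_persistence`,
  p528230.)

OURS (research support for an idea card; candidates, not facts); nothing here is a statement of the manuscript under review
[claim: Hironaka2017, status: under-review]; AI work, weaker than expert review. [cite: CossartPiltant2009, p. 9] [folklore]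
-/

noncomputable section

-- `Summit.<S>.<S>.…` duplicates the summit name by design (single-problem summit).
set_option linter.dupNamespace false

open MvPolynomial
open Summit.ResolutionOfSingularities.ResolutionOfSingularities.Theorems.SwitchingDichotomy.DescentSpace

namespace Summit.ResolutionOfSingularities.ResolutionOfSingularities.Theorems.SwitchingDichotomy.Cone

universe u v

section VertexBridge

variable {κ : Type u} [Field κ] {σ : Type v} [DecidableEq σ]

/-- `dehomTransl_j^{c'} ∘ dehomTransl_j^{c} = dehomTransl_j^{c + c'}`-type law: translating by `c` then by `-c` is the plain
dehomogenisation `X_j ↦ 1` (any characteristic). [folklore] -/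
theorem dehomTransl_neg_dehomTransl (j : σ) (c : σ → κ) (P : MvPolynomial σ κ) :
    dehomTransl κ j (-c) (dehomTransl κ j c P) = aeval (fun i => if i = j then (1 : MvPolynomial σ κ) else X i) P := by
  unfold dehomTransl
  induction P using MvPolynomial.induction_on with
  | C a => rw [aeval_C, MvPolynomial.algebraMap_eq, aeval_C, MvPolynomial.algebraMap_eq, aeval_C,
      MvPolynomial.algebraMap_eq]
  | add p q hp hq => rw [map_add, map_add, hp, hq, map_add]
  | mul_X p i hp =>
    rw [map_mul, map_mul, hp, map_mul, aeval_X, aeval_X]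
    congr 1
    by_cases hi : i = j
    · subst hi; rw [if_pos rfl, if_pos rfl, map_one]
    · rw [if_neg hi, if_neg hi, map_add, aeval_X, aeval_C, MvPolynomial.algebraMap_eq, if_neg hi, Pi.neg_apply,
        C_neg, add_assoc, neg_add_cancel, add_zero]

/-- `(X_j ↦ 1) ∘ η⁻_c = dehomTransl_j^{−c}` for the re-homogenising substitution `η⁻_c : X_i ↦ X_i − c_i X_j` (`i ≠ j`), `X_j ↦ X_j`
(any characteristic). [folklore] -/
theorem aeval_dehom_etaSub (j : σ) (c : σ → κ) (P : MvPolynomial σ κ) :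
    aeval (fun i => if i = j then (1 : MvPolynomial σ κ) else X i)
      (aeval (fun i => if i = j then X j else X i - C (c i) * X j) P) = dehomTransl κ j (-c) P := by
  unfold dehomTransl
  induction P using MvPolynomial.induction_on with
  | C a => rw [aeval_C, MvPolynomial.algebraMap_eq, aeval_C, MvPolynomial.algebraMap_eq, aeval_C,
      MvPolynomial.algebraMap_eq]
  | add p q hp hq => rw [map_add, map_add, hp, hq, map_add]
  | mul_X p i hp =>
    rw [map_mul, map_mul, hp, map_mul, aeval_X, aeval_X]
    congr 1
    by_cases hi : i = j
    · subst hi; rw [if_pos rfl, if_pos rfl, aeval_X, if_pos rfl]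
    · rw [if_neg hi, if_neg hi, map_sub, map_mul, aeval_X, aeval_X, aeval_C, MvPolynomial.algebraMap_eq,
        if_neg hi, if_pos rfl, mul_one, Pi.neg_apply, C_neg, sub_eq_add_neg]

/-- `η⁻_c R` is invariant along `c` when `R` is free of `X_j` and `c_j = 1` (any characteristic:
`X_i − c_i X_j ↦ (X_i + c_i t) − c_i (X_j + t) = X_i − c_i X_j`). [folklore] -/
theorem isLineInvariant_aeval_etaSub {j : σ} {c : σ → κ} (hc : c j = 1) (R : MvPolynomial σ κ)
    (hR : ∀ m ∈ R.support, m j = 0) :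
    IsLineInvariant κ c (aeval (fun i => if i = j then X j else X i - C (c i) * X j) R) := by
  unfold IsLineInvariant
  have hgen : ∀ i, i ≠ j → genTransl κ c ((if i = j then X j else X i - C (c i) * X j : MvPolynomial σ κ)) =
      map (algebraMap κ (Polynomial κ)) (if i = j then X j else X i - C (c i) * X j) := by
    intro i hi
    rw [if_neg hi]
    simp only [map_sub, map_mul, genTransl_X, genTransl_C, map_X, map_C, Polynomial.algebraMap_eq, hc, map_one,
      one_mul]
    ring
  conv_lhs => rw [R.as_sum, map_sum, map_sum]
  conv_rhs => rw [R.as_sum, map_sum, map_sum]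
  refine Finset.sum_congr rfl fun m hm => ?_
  rw [aeval_monomial, MvPolynomial.algebraMap_eq, map_mul, map_mul,
    show genTransl κ c (C (coeff m R)) = map (algebraMap κ (Polynomial κ)) (C (coeff m R)) from isLineInvariant_C c _,
    Finsupp.prod, map_prod, map_prod]
  congr 1
  refine Finset.prod_congr rfl fun i hi => ?_
  have hij : i ≠ j := by
    rintro rfl; exact (Finsupp.mem_support_iff.mp hi) (hR m hm)
  rw [map_pow, map_pow, hgen i hij]

/-- **(TV4, plain) MULTIPLICITY `d` AT A RATIONAL POINT ⇒ CONE OVER IT** (general index type, any characteristic; `Cone.binary_of_mult_eq_deg`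
is the case `σ = Fin 3`): if `Φ` is a form of degree `d` and, at the rational point `c` of the chart `X_j ≠ 0` (`c_j = 1`), every monomial of
the dehomogenised translate `dehomTransl_j^c Φ = Φ(X_j := 1, X_i := X_i + c_i)` has degree `≥ d`, then `Φ` is invariant along `c`
— indeed `Φ = Ψ(X_i − c_i X_j : i ≠ j)` with `Ψ := dehomTransl_j^c Φ`, a form of degree `d` free of `X_j`. [folklore] -/
theorem eq_aeval_etaSub_dehomTransl_of_order_ge (d : ℕ) (j : σ) (Φ : MvPolynomial σ κ) (hΦ : Φ.IsHomogeneous d)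
    (c : σ → κ) (hmult : ∀ m ∈ (dehomTransl κ j c Φ).support, d ≤ m.sum fun _ e => e) :
    (dehomTransl κ j c Φ).IsHomogeneous d ∧ (∀ m ∈ (dehomTransl κ j c Φ).support, m j = 0) ∧
      Φ = aeval (fun i => if i = j then X j else X i - C (c i) * X j) (dehomTransl κ j c Φ) := by
  have hdeg : (dehomTransl κ j c Φ).totalDegree ≤ d :=
    Finset.sup_le fun m hm => (sum_le_of_mem_support_dehomTransl j c Φ hm).trans hΦ.totalDegree_le
  have hΨ : (dehomTransl κ j c Φ).IsHomogeneous d := isHomogeneous_of_totalDegree_le_of_forall _ d hdeg hmult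
  refine ⟨hΨ, dehomTransl_support_free j c Φ, ?_⟩
  have hlin : ∀ i, ((if i = j then X j else X i - C (c i) * X j : MvPolynomial σ κ)).IsHomogeneous 1 := by
    intro i
    by_cases hi : i = j
    · rw [if_pos hi]; exact isHomogeneous_X κ j
    · rw [if_neg hi]; exact (isHomogeneous_X κ i).sub ((isHomogeneous_X κ j).C_mul _)
  refine eq_of_isHomogeneous_of_aeval_dehom_eq j hΦ (isHomogeneous_aeval_of_forall _ hlin hΨ) ?_
  rw [aeval_dehom_etaSub, dehomTransl_neg_dehomTransl]

/-- **(TV4, plain) MULTIPLICITY `d` AT A RATIONAL POINT ⇒ CONE OVER IT** (general index type, any characteristic; `Cone.binary_of_mult_eq_deg`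
is the instance `σ = Fin 3`): if `Φ` is a form of degree `d` and, at the rational point `c` of the chart `X_j ≠ 0` (`c_j = 1`), every monomial
of the dehomogenised translate `dehomTransl_j^c Φ = Φ(X_j := 1, X_i := X_i + c_i)` has degree `≥ d`, then `Φ` is invariant along `c` —
indeed `Φ = Ψ(X_i − c_i X_j : i ≠ j)` with `Ψ := dehomTransl_j^c Φ` a form of degree `d` free of `X_j`
(`eq_aeval_etaSub_dehomTransl_of_order_ge`). [folklore] -/
theorem isLineInvariant_of_dehomTransl_order_ge (d : ℕ) (j : σ) (Φ : MvPolynomial σ κ) (hΦ : Φ.IsHomogeneous d)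
    (c : σ → κ) (hc : c j = 1) (hmult : ∀ m ∈ (dehomTransl κ j c Φ).support, d ≤ m.sum fun _ e => e) :
    IsLineInvariant κ c Φ := by
  obtain ⟨-, hfree, heq⟩ := eq_aeval_etaSub_dehomTransl_of_order_ge d j Φ hΦ c hmult
  rw [heq]
  exact isLineInvariant_aeval_etaSub hc _ hfree

end VertexBridge

end Summit.ResolutionOfSingularities.ResolutionOfSingularities.Theorems.SwitchingDichotomy.Cone

end
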